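import Summits.Ventures.HodgeRepro2.T5InertTopCoefficient
import Summits.Ventures.HodgeRepro2.T5HeckeDegreeIndex
import Summits.Ventures.HodgeRepro2.T5HeckeBasisCells

/-!
# The degree of `Tₙ` as the index of a congruence subgroup
(cell pub-hodge-repro2, seat p3)

Tier-5 N3 support. Files 189–192 leave ONE printed count to the prose of the Satake chain: the degree
sequence `deg Tₙ = #(K aₙ K / K)`. Seat p8's T5-1xx `ncard_orbit_eq_relIndex_inf` writes this degree as the
index `[K : K ∩ aₙ K aₙ⁻¹]`; here the subgroup `K ∩ aₙ K aₙ⁻¹` is identified, entry by entry, with the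
CONGRUENCE SUBGROUP of `K = U(antidiag(1, u, 1)) ∩ GL₃(R)`:

* `isInteger_conj_cell_iff` — for an integral `3 × 3` matrix `m`, `aₙ⁻¹ m aₙ` is integral iff
  `m₀₁ ∈ ϖⁿ R`, `m₀₂ ∈ ϖ²ⁿ R`, `m₁₂ ∈ ϖⁿ R` (the diagonal conjugation `aₙ⁻¹ m aₙ = (ϖ^{−eᵢ} mᵢⱼ ϖ^{eⱼ})`
  with `e = (n, 0, −n)`);
* **`mem_conjK_cellU_iff`** — for `κ ∈ K`: `κ ∈ aₙ K aₙ⁻¹ ↔ κ₀₁ ϖ^{−n}, κ₀₂ ϖ^{−2n}, κ₁₂ ϖ^{−n}` integral;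
* **`ncard_orbit_cellU_eq_relIndex`** — `deg Tₙ = [K : K ∩ aₙ K aₙ⁻¹]` (p8's index formula, restated for
  the cells), so that, with `mem_conjK_cellU_iff`, `deg Tₙ` IS the index of the congruence subgroup
  `{κ ∈ U(R) : κ₀₁ ∈ ϖⁿ R, κ₀₂ ∈ ϖ²ⁿ R, κ₁₂ ∈ ϖⁿ R}` in `U(R)`.

What stays prose: the evaluation of that index, `(q³ + 1) q^{4n−3}` for `n ≥ 1` (the reduction of `U(R)`
modulo `ϖ²ⁿ`).

Mathlib + this seat's files 186–187 + seat p8's T5-1xx (degree index) / T5-123b / T5-136 and their imports; no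
display; no device. §8(d): uses an L-value-free non-vanishing device: NO.
-/

namespace Summit.Ventures.HodgeRepro2.T5InertCongruenceSubgroup

open Summit.Ventures.HodgeRepro2.T5CartanCellsDistinct Summit.Ventures.HodgeRepro2.T5HeckeBasisCells
  Summit.Ventures.HodgeRepro2.T5HermitianThreeElements Summit.Ventures.HodgeRepro2.T5UnitaryGroupForm
  Summit.Ventures.HodgeRepro2.T5UnitaryThreeCorner Summit.Ventures.HodgeRepro2.T5UnitaryHeckeAdjoint
  Summit.Ventures.HodgeRepro2.T5HeckeDegreeIndex Summit.Ventures.HodgeRepro2.T5InertTopCoefficientMatrix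
  Summit.Ventures.HodgeRepro2.T5InertTopCoefficient

/-! ## The diagonal conjugation, entry by entry -/

section Matrix

variable {R E : Type*} [CommRing R] [Field E] [Algebra R E] [IsFractionRing R E] {ϖ : R}
  (hϖ : Irreducible ϖ)

/-- **`aₙ⁻¹ m aₙ` is integral iff `m₀₁ ∈ ϖⁿ R`, `m₀₂ ∈ ϖ²ⁿ R`, `m₁₂ ∈ ϖⁿ R`**, for an integral `m`. -/
theorem isInteger_conj_cell_iff (n : ℕ) {m : Matrix (Fin 3) (Fin 3) E}
    (hm : ∀ i j, IsLocalization.IsInteger R (m i j)) :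
    (∀ i j, IsLocalization.IsInteger R
      (((((cell hϖ n : GL (Fin 3) E)⁻¹ : GL (Fin 3) E) : Matrix (Fin 3) (Fin 3) E) * m *
        ((cell hϖ n : GL (Fin 3) E) : Matrix (Fin 3) (Fin 3) E)) i j)) ↔
    IsLocalization.IsInteger R (m 0 1 * algebraMap R E ϖ ^ (-(n : ℤ))) ∧
      IsLocalization.IsInteger R (m 0 2 * algebraMap R E ϖ ^ (-((2 * n : ℕ) : ℤ))) ∧
      IsLocalization.IsInteger R (m 1 2 * algebraMap R E ϖ ^ (-(n : ℤ))) := by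
  rw [coe_cell_inv, coe_cell']
  set π : E := algebraMap R E ϖ with hπ
  have hπ0 : π ≠ 0 := by
    rw [hπ]
    exact (map_ne_zero_iff _ (IsFractionRing.injective R E)).2 hϖ.ne_zero
  have hπint : ∀ a : ℤ, 0 ≤ a → IsLocalization.IsInteger R (π ^ a) := fun a ha =>
    (isInteger_zpow_iff hϖ a).2 ha
  -- the three entries above the diagonal
  have e01 : (Matrix.diagonal (fun i => π ^ (-(![(n : ℤ), 0, -(n : ℤ)] i))) * m *
      Matrix.diagonal (fun i => π ^ (![(n : ℤ), 0, -(n : ℤ)] i))) 0 1 = m 0 1 * π ^ (-(n : ℤ)) := by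
    simp only [Matrix.mul_diagonal, Matrix.diagonal_mul, Fin.isValue, Matrix.cons_val_zero,
      Matrix.cons_val_one, zpow_zero, mul_one]
    exact mul_comm _ _
  have e02 : (Matrix.diagonal (fun i => π ^ (-(![(n : ℤ), 0, -(n : ℤ)] i))) * m *
      Matrix.diagonal (fun i => π ^ (![(n : ℤ), 0, -(n : ℤ)] i))) 0 2 =
        m 0 2 * π ^ (-((2 * n : ℕ) : ℤ)) := by
    simp only [Matrix.mul_diagonal, Matrix.diagonal_mul, Fin.isValue, Matrix.cons_val_zero,
      Matrix.cons_val_two, Matrix.tail_cons, Matrix.head_cons]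
    rw [mul_comm (π ^ _) (m 0 2), mul_assoc, ← zpow_add₀ hπ0]
    congr 2
    push_cast
    ring
  have e12 : (Matrix.diagonal (fun i => π ^ (-(![(n : ℤ), 0, -(n : ℤ)] i))) * m *
      Matrix.diagonal (fun i => π ^ (![(n : ℤ), 0, -(n : ℤ)] i))) 1 2 = m 1 2 * π ^ (-(n : ℤ)) := by
    simp only [Matrix.mul_diagonal, Matrix.diagonal_mul, Fin.isValue, Matrix.cons_val_zero,
      Matrix.cons_val_one, Matrix.head_cons, Matrix.cons_val_two, Matrix.tail_cons, neg_zero, zpow_zero,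
      one_mul]
  constructor
  · intro h
    exact ⟨e01 ▸ h 0 1, e02 ▸ h 0 2, e12 ▸ h 1 2⟩
  · rintro ⟨h01, h02, h12⟩ i j
    fin_cases i <;> fin_cases j <;>
      simp only [Matrix.mul_diagonal, Matrix.diagonal_mul, Fin.zero_eta, Fin.mk_one, Fin.reduceFinMk,
        Fin.isValue, Matrix.cons_val_zero, Matrix.cons_val_one, Matrix.head_cons, Matrix.cons_val_two,
        Matrix.tail_cons, neg_zero, zpow_zero, mul_one, one_mul, neg_neg]
    · -- (0, 0)
      rw [zpow_neg_mul_mul_zpow hπ0]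
      exact hm 0 0
    · -- (0, 1)
      rw [mul_comm]
      exact h01
    · -- (0, 2)
      convert h02 using 1
      rw [mul_comm (π ^ _) (m 0 2), mul_assoc, ← zpow_add₀ hπ0]
      congr 2
      push_cast
      ring
    · -- (1, 0)
      exact IsLocalization.isInteger_mul (hm 1 0) (hπint _ (by positivity))
    · -- (1, 1)
      exact hm 1 1
    · -- (1, 2)
      exact h12
    · -- (2, 0)
      exact IsLocalization.isInteger_mul (IsLocalization.isInteger_mul (hπint _ (by positivity)) (hm 2 0))
        (hπint _ (by positivity))
    · -- (2, 1)
      exact IsLocalization.isInteger_mul (hπint _ (by positivity)) (hm 2 1)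
    · -- (2, 2)
      rw [mul_comm (π ^ _), mul_assoc, ← zpow_add₀ hπ0, add_neg_cancel, zpow_zero, mul_one]
      exact hm 2 2

end Matrix

/-! ## `K ∩ aₙ K aₙ⁻¹` is the congruence subgroup -/

section Group

variable {R E : Type*} [CommRing R] [Field E] [StarRing E] [Algebra R E] [IsFractionRing R E]
  (hstar : ∀ x : E, IsLocalization.IsInteger R x → IsLocalization.IsInteger R (star x))
  (u : E) (hu0 : u ≠ 0) (hu : IsLocalization.IsInteger R u) (hu' : IsLocalization.IsInteger R u⁻¹)
  {ϖ : R} (hϖ : Irreducible ϖ) (hs : star (algebraMap R E ϖ) = algebraMap R E ϖ)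

include hstar hu0 hu hu' in
/-- **The congruence subgroup**: for `κ ∈ K = U(J₃(u)) ∩ GL₃(R)`, `κ ∈ aₙ K aₙ⁻¹` iff
`κ₀₁ ϖ^{−n}`, `κ₀₂ ϖ^{−2n}` and `κ₁₂ ϖ^{−n}` are integral. -/
theorem mem_conjK_cellU_iff (n : ℕ) {κ : formUnitaryGroup (J3 u)}
    (hκ : κ ∈ hyperspecialSubgroup R (J3 u)) :
    κ ∈ conjK (hyperspecialSubgroup R (J3 u)) (cellU hϖ hs u n) ↔
      IsLocalization.IsInteger R
          (((κ : GL (Fin 3) E) : Matrix (Fin 3) (Fin 3) E) 0 1 * algebraMap R E ϖ ^ (-(n : ℤ))) ∧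
        IsLocalization.IsInteger R
          (((κ : GL (Fin 3) E) : Matrix (Fin 3) (Fin 3) E) 0 2 * algebraMap R E ϖ ^ (-((2 * n : ℕ) : ℤ))) ∧
        IsLocalization.IsInteger R
          (((κ : GL (Fin 3) E) : Matrix (Fin 3) (Fin 3) E) 1 2 * algebraMap R E ϖ ^ (-(n : ℤ))) := by
  have hκint : ∀ i j, IsLocalization.IsInteger R (((κ : GL (Fin 3) E) : Matrix (Fin 3) (Fin 3) E) i j) :=
    T5CartanCellsDistinct.isInteger_apply_of_mem_range ((mem_hyperspecialSubgroup_iff R κ).1 hκ)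
  rw [mem_conjK_iff, mem_hyperspecialSubgroup_iff, ← isInteger_conj_cell_iff hϖ n hκint]
  constructor
  · intro h i j
    have := T5CartanCellsDistinct.isInteger_apply_of_mem_range h i j
    simpa only [Subgroup.coe_mul, Subgroup.coe_inv, Units.val_mul, coe_cellU] using this
  · intro h
    refine mem_range_of_entries hstar u hu0 hu hu' _ ((cellU hϖ hs u n)⁻¹ * κ * cellU hϖ hs u n).2
      fun i j => ?_
    have := h i j
    simpa only [Subgroup.coe_mul, Subgroup.coe_inv, Units.val_mul, coe_cellU] using this

/-- **`deg Tₙ = [K : K ∩ aₙ K aₙ⁻¹]`**: the degree of the cell `K aₙ K` is the index of the congruence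
subgroup (p8's `ncard_orbit_eq_relIndex_inf` for the cells; the subgroup is described by
`mem_conjK_cellU_iff`). -/
theorem ncard_orbit_cellU_eq_relIndex (n : ℕ) :
    (MulAction.orbit (hyperspecialSubgroup R (J3 u))
        ((cellU hϖ hs u n : formUnitaryGroup (J3 u)) :
          formUnitaryGroup (J3 u) ⧸ hyperspecialSubgroup R (J3 u))).ncard =
      (hyperspecialSubgroup R (J3 u) ⊓ conjK (hyperspecialSubgroup R (J3 u)) (cellU hϖ hs u n)).relIndex
        (hyperspecialSubgroup R (J3 u)) :=
  ncard_orbit_eq_relIndex_inf _ _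

end Group

end Summit.Ventures.HodgeRepro2.T5InertCongruenceSubgroup
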